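import Summits.QuantumFields.YangMills.Theorems.FluctuationComparisonRegPrIntLS2BetaRelativeLadderStep
import HarnessLib

/-!
# S2β · (LIFT-V) — THE SECOND PROFILE's OWN RECURSION, §1: THE ONE-SQUARE `V`-STEP (px5 g23's Q11a′ square read for the RUNG PAIR):
# `Ad_{W_top}(U_far⁻¹·W_far)·(U_near⁻¹·W_near)⁻¹ = (covariant rail-pair difference)·Ad_{U_near⁻¹}(□_U⁻¹·□_W)` — EXACT, any torus, any `GaugeGroup`, no smallness

Cell `ym3-torus` (rung R3 = continuum `SU(2)` Yang–Mills on the three-torus — NOT d = 4, NOT infinite volume, NOT a mass gap, NOT Clay).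
Width seat «width 21» `ym3-torus-px21` (gen 24); `--kind proof --supports stmt-QuantumFields-20520 --as helper`, count-neutral, DEFINITION-FREE
(0 `def`, 0 `instance`, 0 `notation`, 0 `sorry`, default heartbeats); generic `P : Params`, ANY `GaugeGroup G`.

WHY (LIFT-LADDER ✓p830137 `supTowerLetter_of_liftLadderLetter`; px16 g22's three-profile bookkeeping `(M, V, ρ)` 17:30:20Z; px20 g23's allocation sentence 17:26:50Z
«(SCT-c)'s supplier budgets `Σ_t L^t·c_t` by running the SECOND profile's own recursion `V_{t+1} ≤ T₂₂·V_t + b_{t+1}` through ✓p829914 (W2)»).  The `V`-profile is the sup of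
COVARIANT ADJACENT-TRANSVERSE DIFFERENCES of relative chords.  px5 g23's Q11a′ ✓p830038 `dist1_farRung_rel_le` reads the unit square for the `M`-row (far-rung CHORD ≤ relative
plaquette + near-rung chord + rail-pair difference); THIS FILE reads the SAME square for the `V`-row: the RUNG-PAIR DIFFERENCE (the transverse difference, in the rail direction
`κ`, of the two `e`-rung chords) IS the rail-pair difference times the transported relative plaquette — EXACTLY:
* §1 `rungPair_eq` — with `□_X := X_bot·X_far·X_top⁻¹·X_near⁻¹`, `T := □_U·U_near`, chords `U⁻¹W` on rungs:
  `W_top·(U_far⁻¹W_far)·W_top⁻¹·(U_near⁻¹W_near)⁻¹ = [(W_top U_top⁻¹)·T⁻¹·(U_bot W_bot⁻¹)·T] · [U_near⁻¹·(□_U⁻¹□_W)·U_near]` (free-group identity, `group`);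
  ★★ `dist1_rungPair_rel_le` — `dist1 (Ad_{W_top}(r_far)·r_near⁻¹) ≤ dist1 (covariant rail-pair difference) + dist1 (□_U⁻¹□_W)`, and ★★ `dist1_railPair_rel_le` — the converse
  `dist1 (rail pair) ≤ dist1 (rung pair) + dist1 (□_U⁻¹□_W)`: ONE square trades the `V`-entry of the `e`-bonds in direction `κ` against the `V`-entry of the `κ`-bonds in direction `e`,
  at the price of one relative plaquette — so the `V`-row closes wherever one of the two pairs is a COMB pair (lifted difference, ✓p829498 `norm_logVec_lift_rel_sub_shift_le_of_support`,
  `L⁻²`), which the lexicographic tree comb guarantees down every axis-`0` run (§2 = the pair-class chase at `d = 3`, next file: `T₂₂ = 5∕L²`).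
* ★ `dist1_rungPair_rel_le_of_transport` — the rung pair transported by `U_top` instead of `W_top` (the typist's `U`-transports) at the commutator price `2·dist1(top chord)·dist1(far chord)`
  under the standard `hcomm` hypothesis (second order in the recursion).

HONEST SCOPE.  Group algebra on one lattice square; nothing of Bałaban's analysis is asserted or proved; the pair-class chase, the aggregation over read sets, (TOP-LAD)∕(LIFT-LAD)∕(SCT-c),
(ST)'s discharge, LOC, D-GUARD, GAP♯∘ (`stub_uniformFibreGapOrbit`, registry untouched, 0∕5), S2β, crux 20520 and `YM3TorusSU2` are NOT proved; no registered stub is closed;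
rung R3 = SU(2) YM₃ on T³ — NOT d = 4, NOT infinite volume, NOT a mass gap, NOT Clay; the Yang–Mills mass gap is NOT proved.
References: T. Bałaban, CMP **122** (1989) 355–392 [Balaban1989LargeFieldII] (p.382, tree-gauge bonds as loops spanned by plaquettes); CMP **98** (1985) 17–51
[Balaban1985Averaging] ((9)–(10) p.19, (19) p.21); CMP **99** (1985) 75–102 [Balaban1985RegularSpaces] ((1.29) p.81: size AND derivative bounds of the small fields).
-/

set_option autoImplicit false

namespace Summit.QuantumFields.YangMills.Theorems.FluctuationComparisonRegPrIntLS2BetaRelativeLadderVarStep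

open Literature.MathematicalPhysics.QuantumFieldTheory.Balaban1983to89
open Literature.MathematicalPhysics.QuantumFieldTheory.Balaban1983to89.T4Continuum

variable {P : Params} {j : ℕ} {G : Type*} [GaugeGroup G]

/-! ## §1 The one-square `V`-step -/

/-- **THE RUNG-PAIR IDENTITY** (one unit square at `z`, rail direction `κ`, rung direction `e`; `□_X = X_bot·X_far·X_top⁻¹·X_near⁻¹`, `T = □_U·U_near`): the far-rung chord
transported back along the top rail (by `W`) against the near-rung chord EQUALS the covariant rail-pair difference times the `U_near`-transported relative plaquette:
`W_top·(U_far⁻¹W_far)·W_top⁻¹·(U_near⁻¹W_near)⁻¹ = [(W_topU_top⁻¹)·T⁻¹·(U_botW_bot⁻¹)·T]·[U_near⁻¹·(□_U⁻¹□_W)·U_near]` (free-group identity).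
[cite: Balaban1989LargeFieldII, p.382; Balaban1985Averaging, (9)-(10) p.19 (bookkeeping)] -/
theorem rungPair_eq (W U : GaugeField P j G) (z : Site P j) (κ e : Fin P.d) :
    W ⟨z.shift e, κ⟩ * ((U ⟨z.shift κ, e⟩)⁻¹ * W ⟨z.shift κ, e⟩) * (W ⟨z.shift e, κ⟩)⁻¹ * ((U ⟨z, e⟩)⁻¹ * W ⟨z, e⟩)⁻¹ =
      ((W ⟨z.shift e, κ⟩ * (U ⟨z.shift e, κ⟩)⁻¹) *
          ((U ⟨z, κ⟩ * U ⟨z.shift κ, e⟩ * (U ⟨z.shift e, κ⟩)⁻¹ * (U ⟨z, e⟩)⁻¹ * U ⟨z, e⟩)⁻¹ * (U ⟨z, κ⟩ * (W ⟨z, κ⟩)⁻¹) *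
            (U ⟨z, κ⟩ * U ⟨z.shift κ, e⟩ * (U ⟨z.shift e, κ⟩)⁻¹ * (U ⟨z, e⟩)⁻¹ * U ⟨z, e⟩))) *
        ((U ⟨z, e⟩)⁻¹ *
          ((U ⟨z, κ⟩ * U ⟨z.shift κ, e⟩ * (U ⟨z.shift e, κ⟩)⁻¹ * (U ⟨z, e⟩)⁻¹)⁻¹ *
            (W ⟨z, κ⟩ * W ⟨z.shift κ, e⟩ * (W ⟨z.shift e, κ⟩)⁻¹ * (W ⟨z, e⟩)⁻¹)) * U ⟨z, e⟩) := by
  set Ub := U ⟨z, κ⟩; set Uf := U ⟨z.shift κ, e⟩; set Ut := U ⟨z.shift e, κ⟩; set Un := U ⟨z, e⟩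
  set Wb := W ⟨z, κ⟩; set Wf := W ⟨z.shift κ, e⟩; set Wt := W ⟨z.shift e, κ⟩; set Wn := W ⟨z, e⟩
  group

/-- ★★ **THE ONE-SQUARE `V`-STEP**: the covariant RUNG-PAIR difference (far-rung chord transported along the top rail vs near-rung chord) is bounded by the covariant RAIL-PAIR
difference (px5 g23's ✓`dist1_farRung_rel_le` third term, verbatim) plus ONE relative plaquette:
`dist1 (W_top·(U_far⁻¹W_far)·W_top⁻¹·(U_near⁻¹W_near)⁻¹) ≤ dist1 ((W_topU_top⁻¹)·T⁻¹·(U_botW_bot⁻¹)·T) + dist1 (□_U⁻¹□_W)` — exact group algebra, no smallness.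
[cite: Balaban1989LargeFieldII, p.382; Balaban1985Averaging, (9)-(10) p.19 (bookkeeping)] -/
theorem dist1_rungPair_rel_le (W U : GaugeField P j G) (z : Site P j) (κ e : Fin P.d) :
    dist1 (W ⟨z.shift e, κ⟩ * ((U ⟨z.shift κ, e⟩)⁻¹ * W ⟨z.shift κ, e⟩) * (W ⟨z.shift e, κ⟩)⁻¹ * ((U ⟨z, e⟩)⁻¹ * W ⟨z, e⟩)⁻¹) ≤
      dist1 ((W ⟨z.shift e, κ⟩ * (U ⟨z.shift e, κ⟩)⁻¹) *
          ((U ⟨z, κ⟩ * U ⟨z.shift κ, e⟩ * (U ⟨z.shift e, κ⟩)⁻¹ * (U ⟨z, e⟩)⁻¹ * U ⟨z, e⟩)⁻¹ * (U ⟨z, κ⟩ * (W ⟨z, κ⟩)⁻¹) *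
            (U ⟨z, κ⟩ * U ⟨z.shift κ, e⟩ * (U ⟨z.shift e, κ⟩)⁻¹ * (U ⟨z, e⟩)⁻¹ * U ⟨z, e⟩))) +
        dist1 ((U ⟨z, κ⟩ * U ⟨z.shift κ, e⟩ * (U ⟨z.shift e, κ⟩)⁻¹ * (U ⟨z, e⟩)⁻¹)⁻¹ *
          (W ⟨z, κ⟩ * W ⟨z.shift κ, e⟩ * (W ⟨z.shift e, κ⟩)⁻¹ * (W ⟨z, e⟩)⁻¹)) := by
  rw [rungPair_eq]
  refine (GaugeGroup.dist1_mul_le _ _).trans (add_le_add le_rfl (le_of_eq ?_))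
  rw [show (U ⟨z, e⟩)⁻¹ *
        ((U ⟨z, κ⟩ * U ⟨z.shift κ, e⟩ * (U ⟨z.shift e, κ⟩)⁻¹ * (U ⟨z, e⟩)⁻¹)⁻¹ *
          (W ⟨z, κ⟩ * W ⟨z.shift κ, e⟩ * (W ⟨z.shift e, κ⟩)⁻¹ * (W ⟨z, e⟩)⁻¹)) * U ⟨z, e⟩ =
      (U ⟨z, e⟩)⁻¹ *
        ((U ⟨z, κ⟩ * U ⟨z.shift κ, e⟩ * (U ⟨z.shift e, κ⟩)⁻¹ * (U ⟨z, e⟩)⁻¹)⁻¹ *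
          (W ⟨z, κ⟩ * W ⟨z.shift κ, e⟩ * (W ⟨z.shift e, κ⟩)⁻¹ * (W ⟨z, e⟩)⁻¹)) * (U ⟨z, e⟩)⁻¹⁻¹ by rw [inv_inv],
    GaugeGroup.dist1_conj]

/-- ★★ **THE CONVERSE**: the covariant RAIL-PAIR difference is bounded by the RUNG-PAIR difference plus one relative plaquette — one square TRADES the `V`-entry of the `e`-bonds in
direction `κ` against the `V`-entry of the `κ`-bonds in direction `e`. [cite: Balaban1989LargeFieldII, p.382; Balaban1985Averaging, (9)-(10) p.19 (bookkeeping)] -/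
theorem dist1_railPair_rel_le (W U : GaugeField P j G) (z : Site P j) (κ e : Fin P.d) :
    dist1 ((W ⟨z.shift e, κ⟩ * (U ⟨z.shift e, κ⟩)⁻¹) *
          ((U ⟨z, κ⟩ * U ⟨z.shift κ, e⟩ * (U ⟨z.shift e, κ⟩)⁻¹ * (U ⟨z, e⟩)⁻¹ * U ⟨z, e⟩)⁻¹ * (U ⟨z, κ⟩ * (W ⟨z, κ⟩)⁻¹) *
            (U ⟨z, κ⟩ * U ⟨z.shift κ, e⟩ * (U ⟨z.shift e, κ⟩)⁻¹ * (U ⟨z, e⟩)⁻¹ * U ⟨z, e⟩))) ≤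
      dist1 (W ⟨z.shift e, κ⟩ * ((U ⟨z.shift κ, e⟩)⁻¹ * W ⟨z.shift κ, e⟩) * (W ⟨z.shift e, κ⟩)⁻¹ * ((U ⟨z, e⟩)⁻¹ * W ⟨z, e⟩)⁻¹) +
        dist1 ((U ⟨z, κ⟩ * U ⟨z.shift κ, e⟩ * (U ⟨z.shift e, κ⟩)⁻¹ * (U ⟨z, e⟩)⁻¹)⁻¹ *
          (W ⟨z, κ⟩ * W ⟨z.shift κ, e⟩ * (W ⟨z.shift e, κ⟩)⁻¹ * (W ⟨z, e⟩)⁻¹)) := by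
  set Ub := U ⟨z, κ⟩; set Uf := U ⟨z.shift κ, e⟩; set Ut := U ⟨z.shift e, κ⟩; set Un := U ⟨z, e⟩
  set Wb := W ⟨z, κ⟩; set Wf := W ⟨z.shift κ, e⟩; set Wt := W ⟨z.shift e, κ⟩; set Wn := W ⟨z, e⟩
  set sqU := Ub * Uf * Ut⁻¹ * Un⁻¹
  set sqW := Wb * Wf * Wt⁻¹ * Wn⁻¹
  set R := (Wt * Ut⁻¹) * ((sqU * Un)⁻¹ * (Ub * Wb⁻¹) * (sqU * Un))
  set D := Wt * (Uf⁻¹ * Wf) * Wt⁻¹ * (Un⁻¹ * Wn)⁻¹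
  set Q := Un⁻¹ * (sqU⁻¹ * sqW) * Un
  -- `D = R·Q` (rungPair_eq), so `R = D·Q⁻¹`
  have hD : D = R * Q := rungPair_eq W U z κ e
  have hR : R = D * Q⁻¹ := by rw [hD, mul_inv_cancel_right]
  rw [hR]
  refine (GaugeGroup.dist1_mul_le _ _).trans (add_le_add le_rfl (le_of_eq ?_))
  rw [GaugeGroup.dist1_inv]
  have h : Q = Un⁻¹ * (sqU⁻¹ * sqW) * Un⁻¹⁻¹ := by rw [inv_inv]
  rw [h, GaugeGroup.dist1_conj]

/-- ★ **THE RUNG PAIR WITH THE `U`-TRANSPORT**: transporting the far-rung chord by `U_top` instead of `W_top` costs the commutator of the top-rail chord with the far-rung chord,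
`dist1 (U_top·r_far·U_top⁻¹·r_near⁻¹) ≤ dist1 (rail pair) + dist1 (□_U⁻¹□_W) + 2·dist1 (U_top⁻¹W_top)·dist1 (r_far)` under the standard commutator hypothesis
`hcomm : dist1 (g h g⁻¹ h⁻¹) ≤ 2·dist1 g·dist1 h` (second order in the recursion). [cite: Balaban1985Averaging, (9)-(10) p.19 (bookkeeping)] -/
theorem dist1_rungPair_rel_le_of_transport (hcomm : ∀ g h : G, dist1 (g * h * g⁻¹ * h⁻¹) ≤ 2 * dist1 g * dist1 h)
    (W U : GaugeField P j G) (z : Site P j) (κ e : Fin P.d) :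
    dist1 (U ⟨z.shift e, κ⟩ * ((U ⟨z.shift κ, e⟩)⁻¹ * W ⟨z.shift κ, e⟩) * (U ⟨z.shift e, κ⟩)⁻¹ * ((U ⟨z, e⟩)⁻¹ * W ⟨z, e⟩)⁻¹) ≤
      dist1 ((W ⟨z.shift e, κ⟩ * (U ⟨z.shift e, κ⟩)⁻¹) *
          ((U ⟨z, κ⟩ * U ⟨z.shift κ, e⟩ * (U ⟨z.shift e, κ⟩)⁻¹ * (U ⟨z, e⟩)⁻¹ * U ⟨z, e⟩)⁻¹ * (U ⟨z, κ⟩ * (W ⟨z, κ⟩)⁻¹) *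
            (U ⟨z, κ⟩ * U ⟨z.shift κ, e⟩ * (U ⟨z.shift e, κ⟩)⁻¹ * (U ⟨z, e⟩)⁻¹ * U ⟨z, e⟩))) +
        dist1 ((U ⟨z, κ⟩ * U ⟨z.shift κ, e⟩ * (U ⟨z.shift e, κ⟩)⁻¹ * (U ⟨z, e⟩)⁻¹)⁻¹ *
          (W ⟨z, κ⟩ * W ⟨z.shift κ, e⟩ * (W ⟨z.shift e, κ⟩)⁻¹ * (W ⟨z, e⟩)⁻¹)) +
        2 * dist1 ((U ⟨z.shift e, κ⟩)⁻¹ * W ⟨z.shift e, κ⟩) * dist1 ((U ⟨z.shift κ, e⟩)⁻¹ * W ⟨z.shift κ, e⟩) := by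
  set Ub := U ⟨z, κ⟩; set Uf := U ⟨z.shift κ, e⟩; set Ut := U ⟨z.shift e, κ⟩; set Un := U ⟨z, e⟩
  set Wb := W ⟨z, κ⟩; set Wf := W ⟨z.shift κ, e⟩; set Wt := W ⟨z.shift e, κ⟩; set Wn := W ⟨z, e⟩
  set rf := Uf⁻¹ * Wf
  set rn := Un⁻¹ * Wn
  set at' := Ut⁻¹ * Wt
  -- `U_t r_f U_t⁻¹ r_n⁻¹ = Ad_{U_t}(r_f a r_f⁻¹ a⁻¹) · (W_t r_f W_t⁻¹ r_n⁻¹)` with `a = U_t⁻¹ W_t`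
  have key : Ut * rf * Ut⁻¹ * rn⁻¹ = Ut * (rf * at' * rf⁻¹ * at'⁻¹) * Ut⁻¹ * (Wt * rf * Wt⁻¹ * rn⁻¹) := by
    simp only [at', rf, rn]; group
  rw [key]
  have h1 := GaugeGroup.dist1_mul_le (Ut * (rf * at' * rf⁻¹ * at'⁻¹) * Ut⁻¹) (Wt * rf * Wt⁻¹ * rn⁻¹)
  have h2 : dist1 (Ut * (rf * at' * rf⁻¹ * at'⁻¹) * Ut⁻¹) ≤ 2 * dist1 at' * dist1 rf := by
    rw [GaugeGroup.dist1_conj]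
    have h := hcomm rf at'
    linarith [mul_comm (dist1 rf) (dist1 at')]
  have h3 := dist1_rungPair_rel_le W U z κ e
  linarith [h1, h2, h3]

end Summit.QuantumFields.YangMills.Theorems.FluctuationComparisonRegPrIntLS2BetaRelativeLadderVarStep
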